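import Summits.RiemannHypothesis.RiemannHypothesis.Theorems.EtaLeadingQuarterSecondMomentAFEMaster
import HarnessLib

/-!
# Sharp-ended eta vector at the zeros, IV: the refined approximate functional equation with
# explicit constants (route EtaLeadingQuarter, item `EtaLeadingSecondMoment`,
# stmt-RiemannHypothesis-21791)

From the master inequality of part III (`norm_zeta_sub_refined_master`) with the auxiliary
parameters `N, V → ∞` chosen large: for `s = 1/2 + it`, `t ≥ 1`, an integer `X ≥ 1`,
`y = t/(2πX)`, `n = [y]`, and boundary layers `Δ₀ ∈ [0, X/2]`, `Δ₁ ≥ 0`,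

`‖ζ(s) − ∑_{m ≤ X} m^{-s} + X^{1-s}/(1-s) − afeCoeff(s) ∑_{ν ≤ n} ν^{s-1}‖`
`  ≤ 9 X^{-1/2} (1 + log(y + 2)) + [n ≥ 1](Δ₀ (X/2)^{-1/2} + (2/π) X^{1/2}/(X{y} + nΔ₀))`
`    + 2Δ₁X^{-1/2} + (4/π) X^{1/2}/(X(1 − {y}) + (n+1)Δ₁)`                (`norm_zeta_sub_refined`).

The two specialisations used by the eta-vector second moment: `Δ₀ = Δ₁ = 0` away from the
transition points `y ∈ ℤ` (`norm_zeta_sub_refined_dist`: the adjacent frequencies cost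
`(2/π)X^{-1/2}/{y} + (4/π)X^{-1/2}/(1 − {y})`), and `Δ ≍ √(X/ν)` near them
(`norm_zeta_sub_refined_transition`: they cost `≤ 7/√y`, uniformly).

RH-free real analysis. Nothing here bears on the truth of RH.
-/

noncomputable section

open Complex MeasureTheory Set Filter intervalIntegral Finset
open scoped Real Topology Interval

set_option linter.dupNamespace false  -- the mandated namespace repeats `RiemannHypothesis`

namespace Summit.RiemannHypothesis.RiemannHypothesis.Theorems.EtaLeadingQuarter.SecondMomentAFE

open Literature.NumberTheory.LFunctions Literature.NumberTheory.LFunctions.AFE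

/-- `‖1/2 + it‖ ≤ 1/2 + t` for `t ≥ 0`. [folklore] -/
theorem norm_half_add_mul_I_le {t : ℝ} (ht : 0 ≤ t) : ‖(1 / 2 : ℂ) + t * I‖ ≤ 1 / 2 + t := by
  calc ‖(1 / 2 : ℂ) + t * I‖ ≤ ‖(1 / 2 : ℂ)‖ + ‖(t : ℂ) * I‖ := norm_add_le _ _
    _ = 1 / 2 + t := by
        rw [norm_mul, Complex.norm_I, mul_one, Complex.norm_real, Real.norm_eq_abs,
          abs_of_nonneg ht]
        norm_num

/-- `(4ac²)^{-1/2} = a^{-1/2}/(2c)` for `a, c > 0`. [folklore] -/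
theorem rpow_neg_half_four_mul {a c : ℝ} (ha : 0 < a) (hc : 0 < c) :
    (4 * a * c ^ 2) ^ (-(1 / 2 : ℝ)) = a ^ (-(1 / 2 : ℝ)) / (2 * c) := by
  have h4 : (4 : ℝ) ^ (-(1 / 2 : ℝ)) = 1 / 2 := by
    rw [show (4 : ℝ) = 2 ^ (2 : ℝ) by norm_num, ← Real.rpow_mul (by norm_num),
      show (2 : ℝ) * -(1 / 2 : ℝ) = -1 by norm_num, Real.rpow_neg_one]
    norm_num
  have hc2 : (c ^ 2 : ℝ) ^ (-(1 / 2 : ℝ)) = c⁻¹ := by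
    rw [← Real.rpow_natCast c 2, ← Real.rpow_mul hc.le,
      show ((2 : ℕ) : ℝ) * -(1 / 2 : ℝ) = -1 by norm_num, Real.rpow_neg_one]
  rw [Real.mul_rpow (by positivity) (by positivity), Real.mul_rpow (by norm_num) ha.le, h4, hc2]
  field_simp

/-- **The refined approximate functional equation with explicit constants.** For `s = 1/2 + it`,
`t ≥ 1`, an integer `X ≥ 1`, `y = t/(2πX)`, `n = [y]`, `0 ≤ Δ₀ ≤ X/2` with `X{y} + nΔ₀ > 0` when
`n ≥ 1`, and `0 ≤ Δ₁`:
`‖ζ(s) − ∑_{m ≤ X} m^{-s} + X^{1-s}/(1-s) − afeCoeff(s) ∑_{ν ≤ n} ν^{s-1}‖`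
`≤ 9X^{-1/2}(1 + log(y+2)) + [n ≥ 1](Δ₀(X/2)^{-1/2} + (2/π)X^{1/2}/(X{y} + nΔ₀))`
`  + 2Δ₁X^{-1/2} + (4/π)X^{1/2}/(X(1 − {y}) + (n+1)Δ₁)`. [folklore] -/
theorem norm_zeta_sub_refined {t : ℝ} {X : ℕ} {Δ₀ Δ₁ : ℝ} (ht1 : 1 ≤ t) (hX1 : 1 ≤ X)
    (hΔ0 : 0 ≤ Δ₀) (hΔ0a : Δ₀ ≤ X / 2)
    (hΔ0pos : 1 ≤ ⌊t / (2 * π * X)⌋₊ →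
      0 < X * Int.fract (t / (2 * π * X)) + ⌊t / (2 * π * X)⌋₊ * Δ₀)
    (hΔ1 : 0 ≤ Δ₁) (s : ℂ) (hs : s = 1 / 2 + t * I) :
    ‖riemannZeta s - ∑ n ∈ Finset.Icc 1 X, (n : ℂ) ^ (-s) + (X : ℂ) ^ (1 - s) / (1 - s)
        - afeCoeff s * ∑ n ∈ Finset.Icc 1 ⌊t / (2 * π * X)⌋₊, (n : ℂ) ^ (s - 1)‖
      ≤ 9 * (X : ℝ) ^ (-(1 / 2 : ℝ)) * (1 + Real.log (t / (2 * π * X) + 2))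
        + (if 1 ≤ ⌊t / (2 * π * X)⌋₊ then
            Δ₀ * ((X : ℝ) / 2) ^ (-(1 / 2 : ℝ)) + 2 / π * (X : ℝ) ^ (1 / 2 : ℝ)
              / (X * Int.fract (t / (2 * π * X)) + ⌊t / (2 * π * X)⌋₊ * Δ₀) else 0)
        + (2 * Δ₁ * (X : ℝ) ^ (-(1 / 2 : ℝ))
          + 4 / π * (X : ℝ) ^ (1 / 2 : ℝ)
            / (X * (1 - Int.fract (t / (2 * π * X))) + (⌊t / (2 * π * X)⌋₊ + 1) * Δ₁)) := by
  have hπ := Real.pi_pos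
  have hπ3 := Real.pi_gt_three
  have ht0 : 0 < t := by linarith
  have hX1R : (1 : ℝ) ≤ X := by exact_mod_cast hX1
  have hX0 : (0 : ℝ) < X := by linarith
  -- the norm of `s`
  have hsn : ‖s‖ ≤ 1 / 2 + t := by rw [hs]; exact norm_half_add_mul_I_le ht0.le
  have hsn0 : 0 ≤ ‖s‖ := norm_nonneg _
  set c : ℝ := 1 + ‖s‖ with hc
  have hc0 : 0 < c := by rw [hc]; linarith
  -- choice of `N`
  obtain ⟨N, hN⟩ : ∃ N : ℕ, (X : ℝ) + Δ₁ + t + 4 * X * c ^ 2 ≤ N := exists_nat_ge _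
  have h4pos : 0 ≤ 4 * (X : ℝ) * c ^ 2 := by positivity
  have haN : (X : ℝ) + Δ₁ ≤ N := by linarith
  have hN4 : 4 * (X : ℝ) * c ^ 2 ≤ N := by linarith
  have hNpos : (0 : ℝ) < N := by linarith
  have htN : t ≤ π * N := by
    have h1 : (N : ℝ) ≤ π * N := le_mul_of_one_le_left (Nat.cast_nonneg N) (by linarith)
    linarith
  -- choice of `V`
  have hK0 : 0 ≤ ‖s‖ * (X : ℝ) ^ (-(1 / 2 : ℝ) - 1) * (N - X + 2) := by
    have : (0 : ℝ) ≤ N - X + 2 := by linarith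
    positivity
  obtain ⟨V₀, hV₀1, hV₀⟩ := exists_sawEta_le
    (δ := (X : ℝ) ^ (-(1 / 2 : ℝ)) / (‖s‖ * (X : ℝ) ^ (-(1 / 2 : ℝ) - 1) * (N - X + 2) + 1))
    (by positivity)
  set V : ℕ := max V₀ (⌊t / (2 * π * X)⌋₊ + 1) with hV
  have hyV : ⌊t / (2 * π * X)⌋₊ + 1 ≤ V := le_max_right _ _
  have hηV := hV₀ V (le_max_left _ _)
  -- the master inequality
  have hM := norm_zeta_sub_refined_master ht0 hX1 hΔ0 hΔ0a hΔ0pos hΔ1 haN htN hyV s hs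
  refine hM.trans ?_
  -- pass to a real abscissa `a` and abbreviate
  generalize haX : (X : ℝ) = a at hΔ0a hΔ0pos hX1R hX0 hN4 haN hK0 hηV ⊢
  set y : ℝ := t / (2 * π * a) with hydef
  set n : ℕ := ⌊y⌋₊ with hn
  set A : ℝ := a ^ (-(1 / 2 : ℝ)) with hA
  set ℓ : ℝ := Real.log (y + 2) with hℓ
  have ha : 0 < a := hX0
  have hA0 : 0 < A := Real.rpow_pos_of_pos ha _
  have hy0 : 0 < y := by rw [hydef]; positivity
  have hty : t = 2 * π * a * y := by rw [hydef]; field_simp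
  have hfl : (n : ℝ) ≤ y := Nat.floor_le hy0.le
  have hfl' : y < n + 1 := Nat.lt_floor_add_one y
  have hn0R : (0 : ℝ) ≤ n := Nat.cast_nonneg n
  have hℓ0 : 0 ≤ ℓ := Real.log_nonneg (by linarith only [hy0])
  have hlogn1 : Real.log ((n : ℝ) + 1) ≤ ℓ :=
    Real.log_le_log (by linarith only [hn0R]) (by linarith only [hfl])
  have hlogn2 : Real.log ((n : ℝ) + 2) ≤ ℓ :=
    Real.log_le_log (by linarith only [hn0R]) (by linarith only [hfl])
  have hlogn : Real.log (n : ℝ) ≤ ℓ := by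
    rcases Nat.eq_zero_or_pos n with h0 | hpos
    · rw [h0, Nat.cast_zero, Real.log_zero]; exact hℓ0
    · exact Real.log_le_log (by exact_mod_cast hpos) (by linarith only [hfl])
  -- `a^{1/2} = a·A`, `a^{-3/2} = A/a`
  have e_half : a ^ (1 / 2 : ℝ) = a * A := by
    rw [hA, show (-(1 / 2 : ℝ)) = (1 / 2 : ℝ) - 1 by norm_num, Real.rpow_sub_one ha.ne']
    field_simp
  have e_m32 : a ^ (-(1 / 2 : ℝ) - 1) = A / a := by
    rw [hA, show -(1 / 2 : ℝ) - 1 = -(1 / 2 : ℝ) + (-1 : ℝ) by ring, Real.rpow_add ha,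
      Real.rpow_neg_one]; ring
  -- `N^{-1/2} ≤ A/(2c)`
  have hNA : (N : ℝ) ^ (-(1 / 2 : ℝ)) ≤ A / (2 * c) := by
    calc (N : ℝ) ^ (-(1 / 2 : ℝ)) ≤ (4 * a * c ^ 2) ^ (-(1 / 2 : ℝ)) :=
          Real.rpow_le_rpow_of_nonpos (by positivity) hN4 (by norm_num)
      _ = A / (2 * c) := by rw [hA]; exact rpow_neg_half_four_mul ha hc0
  have hNA2 : (N : ℝ) ^ (-(1 / 2 : ℝ)) ≤ A / 2 := by
    refine hNA.trans ?_
    rw [div_le_div_iff₀ (by positivity) (by norm_num)]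
    have hc1 : 1 ≤ c := by rw [hc]; linarith only [hsn0]
    exact mul_le_mul_of_nonneg_left (by linarith only [hc1]) hA0.le
  have hN0' : 0 ≤ (N : ℝ) ^ (-(1 / 2 : ℝ)) := by positivity
  -- ‖s‖ against `a` and `n`
  have hπA : 0 ≤ A * (π - 3) := mul_nonneg hA0.le (by linarith only [hπ3])
  have hs_n1 : ‖s‖ ≤ 7 * a * (n + 1) := by
    have h1 : t ≤ 2 * π * a * (n + 1) := by
      rw [hty]; exact mul_le_mul_of_nonneg_left hfl'.le (by positivity)
    have h2 : 2 * π ≤ 6.3 := by linarith only [Real.pi_lt_d2]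
    have h3 : 2 * π * (a * (n + 1)) ≤ 6.3 * (a * (n + 1)) :=
      mul_le_mul_of_nonneg_right h2 (by positivity)
    have hP : 1 ≤ a * (n + 1) := by nlinarith only [hX1R, hn0R]
    linarith only [hsn, h1, h3, hP]
  -- (1) Euler–Maclaurin term
  have b1 : (N : ℝ) ^ (-(1 / 2 : ℝ)) * (1 / 2 + ‖s‖) ≤ A / 2 := by
    calc (N : ℝ) ^ (-(1 / 2 : ℝ)) * (1 / 2 + ‖s‖) ≤ A / (2 * c) * (1 / 2 + ‖s‖) :=
          mul_le_mul_of_nonneg_right hNA (by positivity)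
      _ ≤ A / (2 * c) * c := by gcongr; rw [hc]; linarith
      _ = A / 2 := by field_simp
  -- (2) truncated-Poisson remainder
  have b2 : ‖s‖ * a ^ (-(1 / 2 : ℝ) - 1) * (N - a + 2) * sawEta V ≤ A := by
    set K : ℝ := ‖s‖ * a ^ (-(1 / 2 : ℝ) - 1) * (N - a + 2) with hK
    calc K * sawEta V ≤ K * (A / (K + 1)) := mul_le_mul_of_nonneg_left hηV hK0
      _ ≤ A := by
          rw [← mul_div_assoc, div_le_iff₀ (by positivity)]
          linarith only [hA0.le]
  -- (3) the generic near frequencies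
  have b3a : 4 * (N : ℝ) ^ (-(1 / 2 : ℝ)) / π * (1 + Real.log n) ≤ 2 / 3 * (A * (1 + ℓ)) := by
    have h1 : 4 * (N : ℝ) ^ (-(1 / 2 : ℝ)) / π ≤ 2 / 3 * A := by
      rw [div_le_iff₀ hπ]; linarith only [hNA2, hπA]
    have h2 : 0 ≤ 1 + Real.log (n : ℝ) := by
      rcases Nat.eq_zero_or_pos n with h0 | hpos
      · rw [h0, Nat.cast_zero, Real.log_zero]; norm_num
      · have : 0 ≤ Real.log (n : ℝ) := Real.log_nonneg (by exact_mod_cast hpos)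
        linarith
    calc 4 * (N : ℝ) ^ (-(1 / 2 : ℝ)) / π * (1 + Real.log n)
        ≤ 2 / 3 * A * (1 + Real.log n) := mul_le_mul_of_nonneg_right h1 h2
      _ ≤ 2 / 3 * A * (1 + ℓ) := by gcongr
      _ = 2 / 3 * (A * (1 + ℓ)) := by ring
  have b3b : ((n - 1 : ℕ) : ℝ) * (a ^ (1 / 2 : ℝ) / t) ≤ A / 6 := by
    have h1 : ((n - 1 : ℕ) : ℝ) ≤ y := le_trans (by exact_mod_cast Nat.sub_le n 1) hfl
    calc ((n - 1 : ℕ) : ℝ) * (a ^ (1 / 2 : ℝ) / t) ≤ y * (a ^ (1 / 2 : ℝ) / t) :=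
          mul_le_mul_of_nonneg_right h1 (by positivity)
      _ = A / (2 * π) := by rw [e_half, hty]; field_simp
      _ ≤ A / 6 := div_le_div_of_nonneg_left hA0.le (by norm_num) (by linarith only [hπ3])
  have b3c : 2 / π * a ^ (-(1 / 2 : ℝ)) * (1 + Real.log n) ≤ 2 / 3 * (A * (1 + ℓ)) := by
    have h1 : 2 / π * A ≤ 2 / 3 * A := by
      apply mul_le_mul_of_nonneg_right _ hA0.le
      exact div_le_div_of_nonneg_left (by norm_num) (by norm_num) hπ3.le
    have h2 : 0 ≤ 1 + Real.log (n : ℝ) := by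
      rcases Nat.eq_zero_or_pos n with h0 | hpos
      · rw [h0, Nat.cast_zero, Real.log_zero]; norm_num
      · have : 0 ≤ Real.log (n : ℝ) := Real.log_nonneg (by exact_mod_cast hpos)
        linarith
    calc 2 / π * A * (1 + Real.log n) ≤ 2 / 3 * A * (1 + Real.log n) :=
          mul_le_mul_of_nonneg_right h1 h2
      _ ≤ 2 / 3 * A * (1 + ℓ) := by gcongr
      _ = 2 / 3 * (A * (1 + ℓ)) := by ring
  -- (4) the `N`-parts of the adjacent near frequency
  have b4 : (if 1 ≤ n then 4 * (N : ℝ) ^ (-(1 / 2 : ℝ)) / π + a ^ (1 / 2 : ℝ) / t else 0)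
      ≤ 5 / 6 * A := by
    split_ifs with h1
    · have hy1 : 1 ≤ y := le_trans (by exact_mod_cast h1) hfl
      have e1 : 4 * (N : ℝ) ^ (-(1 / 2 : ℝ)) / π ≤ 2 / 3 * A := by
        rw [div_le_iff₀ hπ]; linarith only [hNA2, hπA]
      have e2 : a ^ (1 / 2 : ℝ) / t ≤ A / 6 := by
        calc a ^ (1 / 2 : ℝ) / t = A / (2 * π * y) := by rw [e_half, hty]; field_simp
          _ ≤ A / 6 := div_le_div_of_nonneg_left hA0.le (by norm_num)
              (by nlinarith only [hπ3, hy1])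
      linarith only [e1, e2]
    · positivity
  -- (5) the integrated terms
  have b5 : ((N : ℝ) ^ (-(1 / 2 : ℝ)) + a ^ (-(1 / 2 : ℝ))) / (2 * π) * (1 + Real.log (n + 1))
      ≤ 1 / 4 * (A * (1 + ℓ)) := by
    have h1 : ((N : ℝ) ^ (-(1 / 2 : ℝ)) + A) / (2 * π) ≤ 1 / 4 * A := by
      rw [div_le_iff₀ (by positivity)]; linarith only [hNA2, hπA]
    have h2 : 0 ≤ 1 + Real.log ((n : ℝ) + 1) := by
      have : 0 ≤ Real.log ((n : ℝ) + 1) := Real.log_nonneg (by linarith only [hn0R])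
      linarith only [this]
    calc ((N : ℝ) ^ (-(1 / 2 : ℝ)) + A) / (2 * π) * (1 + Real.log (n + 1))
        ≤ 1 / 4 * A * (1 + Real.log (n + 1)) := mul_le_mul_of_nonneg_right h1 h2
      _ ≤ 1 / 4 * A * (1 + ℓ) := by gcongr
      _ = 1 / 4 * (A * (1 + ℓ)) := by ring
  -- (6) the generic far frequencies
  have b6 : ‖s‖ * a ^ (-(1 / 2 : ℝ) - 1) / π ^ 2 * ((1 + Real.log (n + 2)) / (n + 1))
      ≤ 7 / 9 * (A * (1 + ℓ)) := by
    rw [e_m32]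
    have hπ2 : 9 ≤ π ^ 2 := by nlinarith only [hπ3]
    have h2 : 0 ≤ 1 + Real.log ((n : ℝ) + 2) := by
      have : 0 ≤ Real.log ((n : ℝ) + 2) := Real.log_nonneg (by linarith only [hn0R])
      linarith only [this]
    have h3 : 1 + Real.log ((n : ℝ) + 2) ≤ 1 + ℓ := by linarith only [hlogn2]
    calc ‖s‖ * (A / a) / π ^ 2 * ((1 + Real.log (n + 2)) / (n + 1))
        = (‖s‖ / (n + 1)) * (1 + Real.log (n + 2)) * (A / a) / π ^ 2 := by
          ring
      _ ≤ (7 * a) * (1 + ℓ) * (A / a) / 9 := by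
          have h4 : ‖s‖ / (n + 1) ≤ 7 * a := by
            rw [div_le_iff₀ (by positivity)]; exact hs_n1
          have h5 : ‖s‖ / (n + 1) * (1 + Real.log (n + 2)) ≤ 7 * a * (1 + ℓ) :=
            mul_le_mul h4 h3 h2 (by positivity)
          have h6 : 0 ≤ ‖s‖ / (n + 1) * (1 + Real.log (n + 2)) * (A / a) := by positivity
          calc ‖s‖ / (n + 1) * (1 + Real.log (n + 2)) * (A / a) / π ^ 2
              ≤ ‖s‖ / (n + 1) * (1 + Real.log (n + 2)) * (A / a) / 9 :=
                div_le_div_of_nonneg_left h6 (by norm_num) hπ2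
            _ ≤ 7 * a * (1 + ℓ) * (A / a) / 9 := by gcongr
      _ = 7 / 9 * (A * (1 + ℓ)) := by field_simp
  -- (7) the adjacent far frequency
  have b7 : ‖s‖ / (2 * π * (n + 1)) * (Δ₁ * a ^ (-(1 / 2 : ℝ) - 1)
        + 2 / π * a ^ (-(1 / 2 : ℝ)) / (a * (1 - Int.fract y) + (n + 1) * Δ₁))
      ≤ 2 * Δ₁ * A + 4 / π * a ^ (1 / 2 : ℝ) / (a * (1 - Int.fract y) + (n + 1) * Δ₁) := by
    have hfr1 : Int.fract y < 1 := Int.fract_lt_one y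
    have hD : 0 < a * (1 - Int.fract y) + (n + 1) * Δ₁ := by
      have : 0 < a * (1 - Int.fract y) := mul_pos ha (by linarith only [hfr1])
      positivity
    have h1 : ‖s‖ / (2 * π * (n + 1)) ≤ 2 * a := by
      rw [div_le_iff₀ (by positivity)]
      have h := mul_le_mul_of_nonneg_right (show (7 : ℝ) ≤ 4 * π by linarith only [hπ3])
        (by positivity : (0 : ℝ) ≤ a * (n + 1))
      linarith only [hs_n1, h]
    have h2 : 0 ≤ Δ₁ * a ^ (-(1 / 2 : ℝ) - 1)
        + 2 / π * a ^ (-(1 / 2 : ℝ)) / (a * (1 - Int.fract y) + (n + 1) * Δ₁) := by positivity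
    calc ‖s‖ / (2 * π * (n + 1)) * (Δ₁ * a ^ (-(1 / 2 : ℝ) - 1)
          + 2 / π * a ^ (-(1 / 2 : ℝ)) / (a * (1 - Int.fract y) + (n + 1) * Δ₁))
        ≤ 2 * a * (Δ₁ * a ^ (-(1 / 2 : ℝ) - 1)
          + 2 / π * a ^ (-(1 / 2 : ℝ)) / (a * (1 - Int.fract y) + (n + 1) * Δ₁)) :=
          mul_le_mul_of_nonneg_right h1 h2
      _ = 2 * Δ₁ * A + 4 / π * a ^ (1 / 2 : ℝ) / (a * (1 - Int.fract y) + (n + 1) * Δ₁) := by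
          rw [e_m32, e_half]; field_simp; ring
  -- (8) the negative frequencies
  have b8 : (if (1 : ℝ) ≤ y then
        2 * ‖s‖ * a ^ (-(1 / 2 : ℝ)) / (π * t) * (1 + Real.log (n + 1))
          + ‖s‖ * a ^ (-(1 / 2 : ℝ) - 1) / π ^ 2 * (1 / n)
      else 2 * ‖s‖ * a ^ (-(1 / 2 : ℝ) - 1) / π ^ 2) ≤ A * (1 + ℓ) + 14 / 9 * A := by
    have hπ2 : 9 ≤ π ^ 2 := by nlinarith only [hπ3]
    split_ifs with hy1
    · have hn1 : 1 ≤ n := Nat.le_floor (by exact_mod_cast hy1)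
      have hn1R : (1 : ℝ) ≤ n := by exact_mod_cast hn1
      have h1 : 2 * ‖s‖ * a ^ (-(1 / 2 : ℝ)) / (π * t) ≤ A := by
        rw [div_le_iff₀ (by positivity)]
        nlinarith only [hsn, ht1, hπ3, hA0.le, mul_pos hA0 ht0]
      have h2 : 0 ≤ 1 + Real.log ((n : ℝ) + 1) := by
        have : 0 ≤ Real.log ((n : ℝ) + 1) := Real.log_nonneg (by linarith only [hn0R])
        linarith only [this]
      have h3 : 2 * ‖s‖ * a ^ (-(1 / 2 : ℝ)) / (π * t) * (1 + Real.log (n + 1))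
          ≤ A * (1 + ℓ) :=
        (mul_le_mul_of_nonneg_right h1 h2).trans
          (mul_le_mul_of_nonneg_left (by linarith only [hlogn1]) hA0.le)
      have h4 : ‖s‖ * a ^ (-(1 / 2 : ℝ) - 1) / π ^ 2 * (1 / n) ≤ 14 / 9 * A := by
        rw [e_m32]
        have hs14 : ‖s‖ ≤ 14 * a * n := by
          have h' : (n : ℝ) + 1 ≤ 2 * n := by linarith only [hn1R]
          have h'' := mul_le_mul_of_nonneg_left h' (by positivity : (0 : ℝ) ≤ 7 * a)
          linarith only [hs_n1, h'']
        calc ‖s‖ * (A / a) / π ^ 2 * (1 / n) = ‖s‖ * A / (a * n) / π ^ 2 := by ring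
          _ ≤ 14 * A / π ^ 2 := by
              apply div_le_div_of_nonneg_right _ (by positivity)
              rw [div_le_iff₀ (by positivity)]
              nlinarith only [hs14, hA0.le]
          _ ≤ 14 * A / 9 := div_le_div_of_nonneg_left (by positivity) (by norm_num) hπ2
          _ = 14 / 9 * A := by ring
      linarith only [h3, h4]
    · rw [not_le] at hy1
      rw [e_m32]
      have hs1 : ‖s‖ ≤ 1 / 2 + 2 * π * a := by
        have : t ≤ 2 * π * a := by
          rw [hty]; exact mul_le_of_le_one_right (by positivity) hy1.le
        linarith only [hsn, this]
      have h1 : 2 * ‖s‖ * (A / a) / π ^ 2 ≤ 14 / 9 * A := by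
        have hs14 : 2 * ‖s‖ ≤ 14 * a := by
          have := mul_le_mul_of_nonneg_right Real.pi_lt_d2.le ha.le
          linarith only [hs1, this, hX1R]
        calc 2 * ‖s‖ * (A / a) / π ^ 2 = (2 * ‖s‖) * A / a / π ^ 2 := by field_simp
          _ ≤ 14 * a * A / a / π ^ 2 := by gcongr
          _ = 14 * A / π ^ 2 := by field_simp
          _ ≤ 14 * A / 9 := div_le_div_of_nonneg_left (by positivity) (by norm_num) hπ2
          _ = 14 / 9 * A := by ring
      linarith only [h1, mul_nonneg hA0.le hℓ0, hA0.le]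
  -- add up
  have hAℓ0 : 0 ≤ A * ℓ := mul_nonneg hA0.le hℓ0
  have hT6 : (N : ℝ) ^ (-(1 / 2 : ℝ)) / 2 ≤ A / 2 := by linarith only [hNA2, hA0.le]
  linarith only [b1, b2, b3a, b3b, b3c, b4, b5, b6, b7, b8, hT6, hAℓ0, hA0.le]

end Summit.RiemannHypothesis.RiemannHypothesis.Theorems.EtaLeadingQuarter.SecondMomentAFE

end
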